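import Summits.QuantumFields.YangMills.Theorems.AtomicSynthesisTensorTorusFourier
import Literature.MathematicalPhysics.QuantumLattice.SchwartzFourierDensity
import Mathlib.Analysis.Complex.OperatorNorm
import Mathlib.Analysis.Distribution.SchwartzSpace.Basic
import HarnessLib

/-!
# Product Fourier expansion of an `n`-slot Schwartz function supported in a product of balls

Helper toward the registered stub `stub_tensorisation` of crux AtomicSynthesis ⟨stmt-QuantumFields-28126⟩
(LINE «SlotwiseSynthesis», ym-idea-11 g13).  A Schwartz function `F` on `(ℝ⁴)ⁿ` supported in
`∏_l B̄(c_l, ρ)` with `ρ^m ‖D^m F‖ ≤ M` (`m ≤ K`) is transported by the affine map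
`y ↦ (c_l + 4ρ(y_{l,·} − ½))_l` to a smooth function on `ℝ^{n×4}` supported in the open unit cube (margin `1/4`),
periodised and Fourier-expanded (`AtomicSynthesisTensorTorusFourier`).  The outcome, `fourier_transport`, is a
coefficient family `G : (Fin n × Fin 4 → ℤ) → ℂ` with

* `∑_k ‖G k‖ < ∞`, `‖G k‖ ≤ M`, and the single-coordinate DECAY `‖G k‖ ≤ M (2/(π|k_p|))^m` (`k_p ≠ 0`, `m ≤ K`)
  — the affine map has linear part of norm `≤ 4ρ`, so `‖D^m (F ∘ affine)‖ ≤ 4^m M`;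
* the expansion `F(z) = ∑_k G k ∏_l e_{k_l}(4⁻¹ρ⁻¹(z_l − c_l) + ½)` whenever every `‖z_l − c_l‖ < 2ρ`
  (the character of `ℤ^{n×4}` FACTORISES over the slots, `eChar_eq_prod_slots`).

HONEST LABEL: elementary Fourier bookkeeping; no crux / rung / summit statement is proved here; the
Yang–Mills mass gap is NOT proved by this file.  Cell `ym-idea-1`, width seat `ym-line-sfw-p2-w3` g37 (free hands).
-/

noncomputable section

open Set Function Filter Topology MeasureTheory Complex UnitAddTorus
open Literature.Analysis.FunctionSpaces
open Literature.MathematicalPhysics.QuantumLattice (eChar absSum contDiff_eChar norm_eChar intForm intForm_apply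
  mFourier_coe_eq_eChar)
open scoped ContDiff Real

namespace Summit.QuantumFields.YangMills.Theorems.AtomicSynthesisTensor

/-! ## The character of `ℤ^{n×4}` factorises over the slots -/

/-- `e_k(y) = exp(2πi ∑_p k_p y_p)` on `ℝ^ι`. [folklore] -/
theorem eChar_eq_exp {ι : Type*} [Fintype ι] (k : ι → ℤ) (y : EuclideanSpace ℝ ι) :
    eChar k y = Complex.exp (↑(2 * π * ∑ p, (k p : ℝ) * y p) * I) := by
  rw [eChar, Real.fourierChar_apply, intForm_apply]

/-- **Slot factorisation of the character**: for `k ∈ ℤ^{n×4}` and `y ∈ ℝ^{n×4}`,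
`e_k(y) = ∏_l e_{k(l,·)}(y(l,·))`. [folklore] -/
theorem eChar_eq_prod_slots {n : ℕ} (k : Fin n × Fin 4 → ℤ) (y : EuclideanSpace ℝ (Fin n × Fin 4)) :
    eChar k y = ∏ l : Fin n, eChar (fun j => k (l, j)) (WithLp.toLp 2 fun j => y (l, j)) := by
  simp_rw [eChar_eq_exp, ← Complex.exp_sum]
  congr 1
  rw [Fintype.sum_prod_type, ← Finset.sum_mul]
  push_cast
  rw [Finset.mul_sum]

/-! ## The slot-extraction map and the affine transport -/

/-- The linear slot-extraction map `y ↦ (y(l,·))_l : ℝ^{n×4} → (ℝ⁴)ⁿ` and its norm bound `≤ 1` (sup of Euclidean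
norms of the rows against the Euclidean norm of the matrix). [folklore] -/
theorem exists_slotCLM (n : ℕ) :
    ∃ T : EuclideanSpace ℝ (Fin n × Fin 4) →L[ℝ] (Fin n → EuclideanSpace ℝ (Fin 4)),
      (∀ y l, T y l = WithLp.toLp 2 fun j => y (l, j)) ∧ ‖T‖ ≤ 1 := by
  let T₀ : EuclideanSpace ℝ (Fin n × Fin 4) →ₗ[ℝ] (Fin n → EuclideanSpace ℝ (Fin 4)) :=
    { toFun := fun y l => WithLp.toLp 2 (fun j => y (l, j))
      map_add' := fun y y' => by funext l; ext j; simp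
      map_smul' := fun a y => by funext l; ext j; simp }
  refine ⟨LinearMap.toContinuousLinearMap T₀, fun y l => rfl, ?_⟩
  refine ContinuousLinearMap.opNorm_le_bound _ zero_le_one fun y => ?_
  rw [one_mul, pi_norm_le_iff_of_nonneg (norm_nonneg y)]
  intro l
  change ‖(WithLp.toLp 2 fun j => y (l, j) : EuclideanSpace ℝ (Fin 4))‖ ≤ ‖y‖
  rw [EuclideanSpace.norm_eq, EuclideanSpace.norm_eq]
  refine Real.sqrt_le_sqrt ?_
  rw [Fintype.sum_prod_type]
  exact Finset.single_le_sum (f := fun l' => ∑ j, ‖y (l', j)‖ ^ 2) (fun _ _ => Finset.sum_nonneg fun _ _ => by positivity)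
    (Finset.mem_univ l)

/-! ## The transport theorem -/

/-- **Product Fourier expansion of an `n`-slot Schwartz function.**  For `F` Schwartz on `(ℝ⁴)ⁿ` supported in
`∏_l B̄(c_l, ρ)` with `ρ^m‖D^m F‖ ≤ M` for `m ≤ K`, there is a coefficient family `G : ℤ^{n×4} → ℂ`, absolutely
summable, with `‖G k‖ ≤ M`, the decay `‖G k‖ ≤ 4^m M/(2π|k_p|)^m` (`k_p ≠ 0`, `m ≤ K`), and
`F(z) = ∑_k G k ∏_l e_{k(l,·)}(4⁻¹ρ⁻¹(z_l − c_l) + ½)` whenever every `‖z_l − c_l‖ < 2ρ`. [folklore] -/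
theorem fourier_transport {n : ℕ} (F : SchwartzMap (Fin n → EuclideanSpace ℝ (Fin 4)) ℝ)
    (c : Fin n → EuclideanSpace ℝ (Fin 4)) {ρ M : ℝ} (hρ : 0 < ρ) {K : ℕ}
    (hsupp : tsupport F ⊆ {z | ∀ l, ‖z l - c l‖ ≤ ρ})
    (hder : ∀ m : ℕ, m ≤ K → ∀ z, ‖iteratedFDeriv ℝ m F z‖ ≤ M / ρ ^ m) :
    ∃ G : (Fin n × Fin 4 → ℤ) → ℂ,
      Summable (fun k => ‖G k‖) ∧ (∀ k, ‖G k‖ ≤ M) ∧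
      (∀ (k : Fin n × Fin 4 → ℤ) (p : Fin n × Fin 4), k p ≠ 0 → ∀ m : ℕ, m ≤ K →
        ‖G k‖ ≤ 4 ^ m * M / (2 * π * |(k p : ℝ)|) ^ m) ∧
      ∀ z : Fin n → EuclideanSpace ℝ (Fin 4), (∀ l, ‖z l - c l‖ < 2 * ρ) →
        HasSum (fun k : Fin n × Fin 4 → ℤ => G k * ∏ l : Fin n, eChar (fun j => k (l, j))
          ((4 : ℝ)⁻¹ • (ρ⁻¹ • (z l - c l)) + WithLp.toLp 2 (fun _ : Fin 4 => (1 / 2 : ℝ))))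
          ((F z : ℝ) : ℂ) := by
  obtain ⟨T, hT, hTnorm⟩ := exists_slotCLM n
  -- the affine transport `Φ y = (4ρ) • T y + z₀`, `z₀ l = c l − 2ρ·𝟙`
  set one4 : EuclideanSpace ℝ (Fin 4) := WithLp.toLp 2 (fun _ : Fin 4 => (1 : ℝ)) with hone4
  set z₀ : Fin n → EuclideanSpace ℝ (Fin 4) := fun l => c l - (2 * ρ) • one4 with hz₀
  set S : EuclideanSpace ℝ (Fin n × Fin 4) →L[ℝ] (Fin n → EuclideanSpace ℝ (Fin 4)) := (4 * ρ) • T with hS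
  have hSapply : ∀ y l j, (S y + z₀) l j = c l j + 4 * ρ * (y (l, j) - 1 / 2) := by
    intro y l j
    have h1 : (S y) l = (4 * ρ) • (WithLp.toLp 2 fun j => y (l, j)) := by
      rw [← hT y l]; rfl
    rw [Pi.add_apply, h1]
    simp [hz₀, hone4]
    ring
  have hSnorm : ‖S‖ ≤ 4 * ρ := by
    rw [hS]
    rw [norm_smul (4 * ρ) T, Real.norm_of_nonneg (by positivity)]
    exact (mul_le_mul_of_nonneg_left hTnorm (by positivity)).trans (le_of_eq (mul_one _))
  -- the transported function
  set g : EuclideanSpace ℝ (Fin n × Fin 4) → ℂ := fun y => ((F (S y + z₀) : ℝ) : ℂ) with hg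
  have hFs : ContDiff ℝ ∞ (fun y : EuclideanSpace ℝ (Fin n × Fin 4) => F (S y + z₀)) :=
    (F.smooth ⊤).comp (S.contDiff.add contDiff_const)
  have hgs : ContDiff ℝ ∞ g := ofRealCLM.contDiff.comp hFs
  -- derivative bounds `‖D^m g‖ ≤ 4^m M`
  have hgder : ∀ m : ℕ, m ≤ K → ∀ y, ‖iteratedFDeriv ℝ m g y‖ ≤ 4 ^ m * M := by
    intro m hm y
    have h1 : ‖iteratedFDeriv ℝ m g y‖ ≤ ‖iteratedFDeriv ℝ m (fun y => F (S y + z₀)) y‖ := by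
      have := ofRealCLM.norm_iteratedFDeriv_comp_left (f := fun y => F (S y + z₀)) (x := y) (n := m)
        hFs.contDiffAt (by exact_mod_cast le_top)
      rw [ofRealCLM_norm, one_mul] at this
      exact this
    have h2 : (fun y => F (S y + z₀)) = (fun z => F (z + z₀)) ∘ S := rfl
    have hF' : ContDiff ℝ ∞ (fun z : Fin n → EuclideanSpace ℝ (Fin 4) => F (z + z₀)) :=
      (F.smooth ⊤).comp (contDiff_id.add contDiff_const)
    have h3 : ‖iteratedFDeriv ℝ m (fun y => F (S y + z₀)) y‖ ≤ ‖iteratedFDeriv ℝ m F (S y + z₀)‖ * ‖S‖ ^ m := by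
      rw [h2, S.iteratedFDeriv_comp_right (f := fun z => F (z + z₀)) hF' y (i := m) (by exact_mod_cast le_top)]
      refine (ContinuousMultilinearMap.norm_compContinuousLinearMap_le _ _).trans ?_
      rw [Finset.prod_const, Finset.card_univ, Fintype.card_fin, iteratedFDeriv_comp_add_right]
    have hM0 : 0 ≤ M := by
      have := hder 0 (Nat.zero_le _) z₀
      rw [pow_zero, div_one] at this
      exact (norm_nonneg _).trans this
    calc ‖iteratedFDeriv ℝ m g y‖ ≤ ‖iteratedFDeriv ℝ m F (S y + z₀)‖ * ‖S‖ ^ m := h1.trans h3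
      _ ≤ M / ρ ^ m * (4 * ρ) ^ m :=
          mul_le_mul (hder m hm (S y + z₀)) (pow_le_pow_left₀ (norm_nonneg _) hSnorm m)
            (pow_nonneg (norm_nonneg _) m) ((norm_nonneg _).trans (hder m hm (S y + z₀)))
      _ = 4 ^ m * M := by
          rw [mul_pow]; field_simp
  -- support in the open unit cube, margin `1/4`
  have hgsupp : tsupport g ⊆ {y | ∀ i, y i ∈ Ioo (0 : ℝ) 1} := by
    refine Torus.tsupport_subset_openCube_of_margin (by norm_num : (0 : ℝ) < 1 / 4) fun y hy => ?_
    obtain ⟨⟨l, j⟩, hlj⟩ := hy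
    rw [hg]
    simp only
    by_contra hne
    have hne' : F (S y + z₀) ≠ 0 := fun h => hne (by rw [h]; simp)
    have hmem : S y + z₀ ∈ tsupport F := subset_tsupport _ hne'
    have hl := hsupp hmem l
    have hcoord : |(S y + z₀) l j - c l j| ≤ ρ := by
      have := PiLp.norm_apply_le ((S y + z₀) l - c l) j
      rw [Real.norm_eq_abs, PiLp.sub_apply] at this
      exact this.trans hl
    rw [hSapply] at hcoord
    rw [show c l j + 4 * ρ * (y (l, j) - 1 / 2) - c l j = 4 * ρ * (y (l, j) - 1 / 2) by ring, abs_mul,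
      abs_of_pos (by positivity : (0 : ℝ) < 4 * ρ)] at hcoord
    have h14 : |y (l, j) - 1 / 2| ≤ 1 / 4 := by
      by_contra hc
      push Not at hc
      have : ρ < 4 * ρ * |y (l, j) - 1 / 2| := by nlinarith
      linarith
    apply hlj
    rw [abs_le] at h14
    constructor <;> linarith [h14.1, h14.2]
  -- the coefficients
  refine ⟨fun k => mFourierCoeff (Torus.periodize g) k, summable_norm_mFourierCoeff_periodize hgs hgsupp,
    fun k => ?_, fun k p hk m hm => ?_, fun z hz => ?_⟩
  · refine norm_mFourierCoeff_periodize_le_of_norm_le hgsupp k fun y => ?_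
    have := hgder 0 (Nat.zero_le _) y
    rwa [norm_iteratedFDeriv_zero, pow_zero, one_mul] at this
  · exact norm_mFourierCoeff_periodize_le hgs hgsupp p m hk (hgder m hm)
  · -- the expansion at `y = Ψ z`
    set y : EuclideanSpace ℝ (Fin n × Fin 4) :=
      WithLp.toLp 2 (fun q : Fin n × Fin 4 => (z q.1 q.2 - c q.1 q.2) / (4 * ρ) + 1 / 2) with hy
    have hyq : ∀ l j, y (l, j) = (z l j - c l j) / (4 * ρ) + 1 / 2 := fun l j => by simp [hy]
    have hycube : ∀ q, y q ∈ Ioo (0 : ℝ) 1 := by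
      rintro ⟨l, j⟩
      rw [hyq]
      have h1 : |z l j - c l j| < 2 * ρ := by
        have := PiLp.norm_apply_le (z l - c l) j
        rw [Real.norm_eq_abs, PiLp.sub_apply] at this
        exact lt_of_le_of_lt this (hz l)
      rw [abs_lt] at h1
      constructor
      · have : -(1 / 2 : ℝ) < (z l j - c l j) / (4 * ρ) := by
          rw [lt_div_iff₀ (by positivity)]; linarith
        linarith
      · have : (z l j - c l j) / (4 * ρ) < 1 / 2 := by
          rw [div_lt_iff₀ (by positivity)]; linarith
        linarith
    have hyunit : y ∈ Torus.unitCube (Fin n × Fin 4) := fun q => Ioo_subset_Ico_self (hycube q)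
    have hexp := hasSum_mFourier_of_mem_unitCube hgs hgsupp hyunit
    -- `g y = F z`
    have hSy : S y + z₀ = z := by
      funext l; ext j
      rw [hSapply, hyq]
      field_simp
      ring
    have hgy : g y = ((F z : ℝ) : ℂ) := by rw [hg]; simp only [hSy]
    rw [hgy] at hexp
    refine hexp.congr_fun fun k => ?_
    congr 1
    -- the character at `proj y` factorises over the slots
    have hchar : mFourier k (Torus.proj y) = eChar k y := by
      have h1 : Torus.proj y = fun q => (((fun q => y q) q : ℝ) : UnitAddCircle) := rfl
      rw [h1, mFourier_coe_eq_eChar]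
    rw [hchar, eChar_eq_prod_slots]
    refine Finset.prod_congr rfl fun l _ => ?_
    congr 1
    ext j
    simp only [hyq, PiLp.add_apply, PiLp.smul_apply, PiLp.sub_apply, smul_eq_mul]
    field_simp

end Summit.QuantumFields.YangMills.Theorems.AtomicSynthesisTensor

end
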